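import Literature.Computability.AlgebraicComplexity.SchoenhageTauBini
import Literature.Barriers.MatrixMultiplication.IrreversibilityBarrierProofs
import Literature.Barriers.MatrixMultiplication.UniversalMethodBarrierAsymptoticRank
import Literature.Barriers.MatrixMultiplication.UniversalMethodBarrierProducts
import HarnessLib

/-!
# `R̃(⟨f⟩ ⊗ s) ≤ f · R̃(s)` and border rank as a degeneration of `⟨r⟩` — proved

Topic `Literature/Computability/AlgebraicComplexity`.  Small asymptotic-rank tools used by the
laser-method records (`RectangularExponentProofs.lean`), all PROVED:

* `tensorRestrictsTo_kroneckerPow_kronecker` — `x^{⊗n} ⊗ y^{⊗n} ≥ (x ⊗ y)^{⊗n}` (relabelling);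
  `asymptoticRank_unitTensor_le` — `R̃(⟨r⟩) ≤ r`; **`asymptoticRank_multiple_le` —
  `R̃(⟨f⟩ ⊗ s) ≤ f · R̃(s)`** (the direct sum of `f` copies; ADVXXZ 2025 §3.2).
* The bridge between the tree's two border-rank formalisms: an order-`h` approximate decomposition
  with `r` triads over `K[ε]` (`IsApproxDecomposition`, `approxRank`, `SchoenhageTau.lean`, Bläser
  2013 Def. 6.1) IS a degeneration `⟨r⟩ ⊵ t` in the sense of Alman 2021 §2.4 (`PolyDegeneratesTo`,
  `UniversalMethodBarrier.lean`): `IsApproxDecomposition.polyDegeneratesTo_unitTensor`,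
  `polyDegeneratesTo_unitTensor_of_approxRank_le` (BCS 1997, (15.19)/Lemma (15.23):
  `bR(t) ≤ r ⟺ t ⊴ ⟨r⟩`).
* Used by `RectangularExponentLaserCertificate.lean` together with `R̃(CW_q) ≤ q + 2`
  (`asymptoticRank_bigCwTensor_le`, `BigCoppersmithWinogradProofs.lean`) and `R̃ ≤ bR`
  (`AsymptoticRankBorderRank.lean`).

## References

* J. Alman, R. Duan, V. Vassilevska Williams, Y. Xu, Z. Xu, R. Zhou, SODA 2025, arXiv:2404.16349,
  §3.2 (`R̃` of direct sums and powers).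
  [AlmanDuanVassilevskaWilliamsXuXuZhou2025]
* P. Bürgisser, M. Clausen, M. A. Shokrollahi, *Algebraic Complexity Theory* (1997), (15.19),
  Lemma (15.23). [BurgisserClausenShokrollahi1997]
* M. Bläser, *Fast Matrix Multiplication*, ToC Graduate Surveys 5 (2013), Def. 6.1. [Blaser2013]
-/

noncomputable section

open scoped BigOperators Polynomial

namespace Literature.Computability.AlgebraicComplexity

open Literature.Barriers.MatrixMultiplication Polynomial

universe u

/-! ## `x^{⊗n} ⊗ y^{⊗n} ≥ (x ⊗ y)^{⊗n}` -/

section Multiple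

variable {K : Type u} [CommSemiring K]
variable {ι κ μ ι' κ' μ' : Type*} [Fintype ι] [Fintype κ] [Fintype μ] [Fintype ι'] [Fintype κ']
  [Fintype μ'] [DecidableEq ι] [DecidableEq κ] [DecidableEq μ] [DecidableEq ι'] [DecidableEq κ']
  [DecidableEq μ']

/-- **`x^{⊗n} ⊗ y^{⊗n} ≥ (x ⊗ y)^{⊗n}`** (relabelling of coordinates). [folklore] -/
theorem tensorRestrictsTo_kroneckerPow_kronecker (x : ι → κ → μ → K) (y : ι' → κ' → μ' → K)
    (n : ℕ) :
    TensorRestrictsTo (kroneckerTensor (kroneckerPow x n) (kroneckerPow y n))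
      (kroneckerPow (kroneckerTensor x y) n) := by
  induction n with
  | zero =>
    refine ⟨fun _ _ => 1, fun _ _ => 1, fun _ _ => 1, fun a' b' c' => ?_⟩
    simp [kroneckerPow_apply]
  | succ n ih =>
    have hx : TensorRestrictsTo (kroneckerPow x (n + 1)) (kroneckerTensor x (kroneckerPow x n)) := by
      rw [kroneckerTensor_kroneckerPow_eq]
      exact tensorRestrictsTo_precomp _ _ _ _
    have hy : TensorRestrictsTo (kroneckerPow y (n + 1)) (kroneckerTensor y (kroneckerPow y n)) := by
      rw [kroneckerTensor_kroneckerPow_eq]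
      exact tensorRestrictsTo_precomp _ _ _ _
    have h2 := tensorRestrictsTo_kronecker_interchange x (kroneckerPow x n) y (kroneckerPow y n)
    have h3 : TensorRestrictsTo
        (kroneckerTensor (kroneckerTensor x y) (kroneckerTensor (kroneckerPow x n) (kroneckerPow y n)))
        (kroneckerTensor (kroneckerTensor x y) (kroneckerPow (kroneckerTensor x y) n)) :=
      (TensorRestrictsTo.refl _).kronecker ih
    have h4 : TensorRestrictsTo
        (kroneckerTensor (kroneckerTensor x y) (kroneckerPow (kroneckerTensor x y) n))
        (kroneckerPow (kroneckerTensor x y) (n + 1)) := by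
      rw [kroneckerPow_succ_eq (kroneckerTensor x y) n]
      exact tensorRestrictsTo_precomp _ _ _ _
    exact (hx.kronecker hy).trans (h2.trans (h3.trans h4))

end Multiple

/-! ## Approximate decompositions are degenerations of unit tensors -/

section BorderToDegeneration

variable {K : Type u} [CommSemiring K]
variable {ι κ μ : Type*}

/-- The unit tensor collapses the triple sum of a polynomial substitution to a single sum.
[folklore] -/
theorem sum_unitTensor_polySubst {r : ℕ} (A : Fin r → ι → K[X]) (B : Fin r → κ → K[X])
    (D : Fin r → μ → K[X]) (a' : ι) (b' : κ) (c' : μ) :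
    (∑ a, ∑ b, ∑ c, C (unitTensor K r a b c) * (A a a' * B b b' * D c c')) =
      ∑ ρ, A ρ a' * B ρ b' * D ρ c' := by
  refine Finset.sum_congr rfl fun a _ => ?_
  rw [Finset.sum_eq_single_of_mem a (Finset.mem_univ a)]
  · rw [Finset.sum_eq_single_of_mem a (Finset.mem_univ a)]
    · simp
    · intro c _ hc
      simp [unitTensor_apply, Ne.symm hc]
  · intro b _ hb
    refine Finset.sum_eq_zero fun c _ => ?_
    simp [unitTensor_apply, Ne.symm hb]

/-- **An approximate decomposition with `r` triads is a degeneration `⟨r⟩ ⊵ t`** (the same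
polynomial vectors, read as the three `K[ε]`-matrices of the degeneration; BCS 1997, (15.19) and
Lemma (15.23): `bR(t) ≤ r ⟺ t ⊴ ⟨r⟩`). [cite: BurgisserClausenShokrollahi1997, Lemma (15.23)] -/
theorem IsApproxDecomposition.polyDegeneratesTo_unitTensor {h : ℕ} {t : ι → κ → μ → K} {r : ℕ}
    {u : Fin r → ι → K[X]} {v : Fin r → κ → K[X]} {w : Fin r → μ → K[X]}
    (huvw : IsApproxDecomposition h t u v w) : PolyDegeneratesTo (unitTensor K r) t := by
  refine ⟨h, u, v, w, fun a' b' c' j hj => ?_⟩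
  rw [sum_unitTensor_polySubst]
  exact huvw a' b' c' j hj

/-- **`R_h(t) ≤ r ⇒ ⟨r⟩ ⊵ t`** for finite formats (the minimum `R_h(t)` is attained, and
`⟨r⟩ ≥ ⟨R_h(t)⟩` by zero-padding). [cite: BurgisserClausenShokrollahi1997, Lemma (15.23)] -/
theorem polyDegeneratesTo_unitTensor_of_approxRank_le [Fintype ι] [Fintype κ] [Fintype μ]
    [DecidableEq ι] [DecidableEq κ] [DecidableEq μ] {h r : ℕ} {t : ι → κ → μ → K}
    (hr : approxRank h t ≤ r) : PolyDegeneratesTo (unitTensor K r) t := by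
  obtain ⟨u, v, w, huvw⟩ := exists_isApproxDecomposition_approxRank h t
  exact (tensorRestrictsTo_unitTensor_castLE hr).trans_polyDegeneratesTo
    huvw.polyDegeneratesTo_unitTensor

end BorderToDegeneration

/-! ## `R̃(⟨r⟩) ≤ r`, `R̃(⟨f⟩ ⊗ s) ≤ f R̃(s)` -/

section AsymptoticRank

variable (K : Type) [Field K]
variable {ι κ μ : Type} [Fintype ι] [Fintype κ] [Fintype μ] [DecidableEq ι] [DecidableEq κ]
  [DecidableEq μ]

/-- **`R̃(⟨r⟩) ≤ r`** (`R̃ ≤ R` and `R(⟨r⟩) ≤ r`). [folklore] -/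
theorem asymptoticRank_unitTensor_le (r : ℕ) : asymptoticRank (unitTensor K r) ≤ r := by
  have h1 := (unitTensor_pow_restrictsTo (K := K) r 1).tensorRank_le
  have h2 : tensorRank (unitTensor K (r ^ 1)) ≤ r ^ 1 := tensorRank_unitTensor_le (K := K) (r ^ 1)
  have h : tensorRank (kroneckerPow (unitTensor K r) 1) ≤ r := h1.trans (h2.trans (pow_one r).le)
  exact (asymptoticRank_le_tensorRank_pow_one _).trans (by exact_mod_cast h)

/-- **`R̃(⟨f⟩ ⊗ s) ≤ f · R̃(s)`**: the asymptotic rank of `f` independent copies of `s` (from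
`R((⟨f⟩ ⊗ s)^{⊗n}) ≤ R(⟨fⁿ⟩ ⊗ s^{⊗n}) ≤ fⁿ R(s^{⊗n})`, subadditivity of the rank; ADVXXZ 2025 §3.2).
[cite: AlmanDuanVassilevskaWilliamsXuXuZhou2025, §3.2] -/
theorem asymptoticRank_multiple_le (f : ℕ) (s : ι → κ → μ → K) :
    asymptoticRank (kroneckerTensor (unitTensor K f) s) ≤ f * asymptoticRank s := by
  have key : ∀ n : ℕ, 0 < n → asymptoticRank (kroneckerTensor (unitTensor K f) s) ≤
      f * ((tensorRank (kroneckerPow s n) : ℝ)) ^ ((n : ℝ)⁻¹) := by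
    intro n hn
    have h1 := asymptoticRank_le_rpow (kroneckerTensor (unitTensor K f) s) hn
    have h2 : tensorRank (kroneckerPow (kroneckerTensor (unitTensor K f) s) n) ≤
        f ^ n * tensorRank (kroneckerPow s n) :=
      calc tensorRank (kroneckerPow (kroneckerTensor (unitTensor K f) s) n)
          ≤ tensorRank (kroneckerTensor (kroneckerPow (unitTensor K f) n) (kroneckerPow s n)) :=
            (tensorRestrictsTo_kroneckerPow_kronecker _ _ n).tensorRank_le
        _ ≤ tensorRank (kroneckerTensor (unitTensor K (f ^ n)) (kroneckerPow s n)) :=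
            ((unitTensor_pow_restrictsTo (K := K) f n).kronecker (TensorRestrictsTo.refl _)).tensorRank_le
        _ ≤ f ^ n * tensorRank (kroneckerPow s n) := tensorRank_multiple_le _ _
    have h2' : ((tensorRank (kroneckerPow (kroneckerTensor (unitTensor K f) s) n) : ℝ)) ≤
        (f : ℝ) ^ n * (tensorRank (kroneckerPow s n) : ℝ) := by exact_mod_cast h2
    refine h1.trans ?_
    calc ((tensorRank (kroneckerPow (kroneckerTensor (unitTensor K f) s) n) : ℝ)) ^ ((n : ℝ)⁻¹)
        ≤ ((f : ℝ) ^ n * (tensorRank (kroneckerPow s n) : ℝ)) ^ ((n : ℝ)⁻¹) :=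
          Real.rpow_le_rpow (by positivity) h2' (by positivity)
      _ = f * ((tensorRank (kroneckerPow s n) : ℝ)) ^ ((n : ℝ)⁻¹) := by
          rw [Real.mul_rpow (by positivity) (by positivity),
            Real.pow_rpow_inv_natCast (by positivity) hn.ne']
  rcases Nat.eq_zero_or_pos f with rfl | hf
  · have h := key 1 one_pos
    simp only [Nat.cast_zero, zero_mul] at h ⊢
    exact h
  · have hf0 : (0 : ℝ) < f := by exact_mod_cast hf
    rw [← div_le_iff₀' hf0]
    refine le_ciInf fun N => ?_
    have hexp : ((N : ℝ) + 1)⁻¹ = (((N + 1 : ℕ) : ℝ))⁻¹ := by push_cast; ring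
    rw [div_le_iff₀' hf0, hexp]
    exact key (N + 1) (Nat.succ_pos N)

end AsymptoticRank

end Literature.Computability.AlgebraicComplexity

end
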